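import Mathlib
import Summits.ResolutionOfSingularities.ResolutionOfSingularities.Theorems.RadicialJungCleanModelsContactChainClean
import HarnessLib

/-!
# Route `RadicialJung`, crux `CleanModels` (stmt-ResolutionOfSingularities-15917), line `Sketch` rev 35, stub 6 `stub_cleanProp44` (X44c),
# work plan O8 / L7b: SEVERAL transversal clean components along ONE chain of point blowing ups («m ≥ 2 starts»)

`Theorems/RadicialJungCleanModelsContactChainClean.lean` (✓ p693282) assembles L7b phase 1 for ONE old charged component `V(s)`,
`s = γ w^k + s₀` in contact normal form, not containing the regular curve `C₀`: along ANY chain of `k` point blowing ups following the curve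
the contact is used up and at a charged landing (`p ∤ k a`) the line is clean-permissible for the strict transform of the curve.  Its
docstring lists what is NOT there; this file does the item «several old components through `x₀` (`m ≥ 2` starts)»:

* `contact_family_along_pointChain` — the FAMILY version of `contact_along_pointChain`, valid for chains of ANY length `n` (also beyond the
  contacts): for a finite family `s_i = γ_i w^{k_i} + s₀ᵢ` (`γ_i` units, `s₀ᵢ ∈ 𝓘_{C₀,x₀}`, ONE transversal coordinate `w`), at the end point
  `x` of a chain of `n` point blowing ups following `C₀` there is ONE exceptional coordinate `e` transversal to the strict transform `C` with
  `σ^#(s_i) = c_i · e^{min(n, k_i)} · (γ_i' e^{k_i − n} + π_i')` for every `i` (`c_i, γ_i'` units, `π_i' ∈ 𝓘_{C,x}`).  The one-step engine is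
  the landed `contact_drop_of_isBlowup_point` (✓ p690623); two generators of the exceptional ideal at `x` differ by a unit (the stalk is a
  regular local ring, hence a domain), which is how the coordinates produced for different members of the family are aligned; past the contact
  (`n ≥ k_i`) the residual factor is a unit and is simply carried along (`σ^#(e) = v · e'`).
* `cleanPermissibleAt_of_pointChain_chargedLanding_family` — **L7b phase 1 for `m` transversal components**: if the line of `G` at `x₀` is
  presented as `Σ_j c_j^p G^j = u₀ · ∏_i (γ_i w^{k_i} + s₀ᵢ)^{a_i}` and the chain has length `n ≥ max_i k_i`, then at `x` the line of `σ^♯ G` is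
  presented as `(unit) · e^{Σ_i k_i a_i}`, hence CLEAN-PERMISSIBLE for the centre `C` whenever the landing is charged, `p ∤ Σ_i k_i a_i`
  (`cleanPermissibleAt_of_chargedLanding`, ✓ p692062).  The case `m = 1`, `n = k` is ✓ `cleanPermissibleAt_of_pointChain_chargedLanding`.
What is still NOT here (rest of O8): the uncharged landing `p ∣ Σ k_i a_i` (form (2) is ✓ `cleanPermissibleAt_of_unit`; form (3) restarts),
and clean components CONTAINING the curve mixed with transversal ones (a lone family of components containing the curve is
✓ `cleanPermissibleAt_of_split` with `q = 0`).

Honest framing: OURS (elementary local algebra of point blowing ups, [CJS 2020] proof of Thm. 6.28 Step 5 / [CoP1] p. 10 for several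
components at once); nothing here proves resolution in characteristic `p`, X44c, or any case of `CleanModels`.
-/

noncomputable section

set_option linter.dupNamespace false -- mandated namespace of this single-conjunct summit

open CategoryTheory AlgebraicGeometry TopologicalSpace IsLocalRing
open Literature.AlgebraicGeometry.Resolution Literature.AlgebraicGeometry.Motives
open Scheme.IdealSheafData

universe u

namespace Summit.ResolutionOfSingularities.ResolutionOfSingularities.Theorems.RadicialJung.CleanModels

/-- Two generators of the same principal ideal of a regular local ring differ by a unit (a regular local ring is a domain,
Matsumura Thm. 14.3). [cite: Matsumura1987, Thm. 14.3] -/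
theorem exists_isUnit_mul_eq_of_span_singleton_eq {R : Type u} [CommRing R] [IsRegularLocalRing R] {a b : R}
    (h : Ideal.span ({a} : Set R) = Ideal.span {b}) : ∃ d : R, IsUnit d ∧ a = d * b := by
  haveI := isDomain_of_isRegularLocalRing R
  obtain ⟨u, hu⟩ := (Ideal.span_singleton_eq_span_singleton.mp h).symm
  exact ⟨(u : R), u.isUnit, by rw [← hu, mul_comm]⟩

/-- **Several contact normal forms along one chain of point blowing ups.**  See the module docstring: the family version of
`contact_along_pointChain`, for chains of any length `n`; the exponent of the common exceptional coordinate `e` on the `i`-th member is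
`min (n, k_i)` and the residual contact is `k_i - n` (so past the contact the residual factor `γ_i' + π_i'` is a unit).
[cite: CossartJannsenSaito2020, proof of Thm. 6.28, Step 5] [cite: CossartPiltant2008, Prop. 4.4 (proof, p. 10)] -/
theorem contact_family_along_pointChain {X₀ X : Scheme.{u}} {σ : X ⟶ X₀} {C₀ : Closeds X₀} {C : Closeds X} {x : X} {n : ℕ}
    (h : IsPointChainAlong σ C₀ C x n) [IsLocallyNoetherian X₀] [IsLocallyNoetherian X] (hX₀ : Scheme.IsRegular X₀)
    (hC₀reg : ∀ y ∈ (C₀ : Set X₀), ∃ c : Fin 2 → X₀.presheaf.stalk y,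
      IsRsopPart c ∧ Ideal.span (Set.range c) = stalkIdeal (vanishingIdeal C₀) y)
    (hxC₀ : σ x ∈ (C₀ : Set X₀)) (hdim₀ : ringKrullDim (X₀.presheaf.stalk (σ x)) = 3)
    (w : X₀.presheaf.stalk (σ x)) (hw : stalkIdeal (vanishingIdeal C₀) (σ x) ⊔ Ideal.span {w} = maximalIdeal _)
    {m : ℕ} (γ s₀ : Fin m → X₀.presheaf.stalk (σ x)) (hγ : ∀ i, IsUnit (γ i))
    (hs₀ : ∀ i, s₀ i ∈ stalkIdeal (vanishingIdeal C₀) (σ x)) (k : Fin m → ℕ) :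
    Scheme.IsRegular X ∧
    (∀ y ∈ (C : Set X), ∃ c : Fin 2 → X.presheaf.stalk y, IsRsopPart c ∧ Ideal.span (Set.range c) = stalkIdeal (vanishingIdeal C) y) ∧
    x ∈ (C : Set X) ∧ ringKrullDim (X.presheaf.stalk x) = 3 ∧
    ∃ e : X.presheaf.stalk x, stalkIdeal (vanishingIdeal C) x ⊔ Ideal.span {e} = maximalIdeal _ ∧
      ∀ i, ∃ (c γ' π' : X.presheaf.stalk x), IsUnit c ∧ IsUnit γ' ∧ π' ∈ stalkIdeal (vanishingIdeal C) x ∧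
        (σ.stalkMap x).hom (γ i * w ^ k i + s₀ i) = c * e ^ min n (k i) * (γ' * e ^ (k i - n) + π') := by
  induction h with
  | nil C₀ x₀ =>
    refine ⟨hX₀, hC₀reg, hxC₀, hdim₀, w, hw, fun i => ⟨1, γ i, s₀ i, isUnit_one, hγ i, hs₀ i, ?_⟩⟩
    rw [Scheme.Hom.stalkMap_id]
    simp only [Nat.zero_min, pow_zero, one_mul, Nat.sub_zero]
    rfl
  | @cons X X' _ _ σ C₀ C n τ x' hx hchain hYreg hτ hx' ih =>
    -- the induction hypothesis at the previous point `τ x'` (note `(τ ≫ σ) x' = σ (τ x')`)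
    obtain ⟨hX, hCreg, hxC, hdim, e, he, hfam⟩ := ih hC₀reg hxC₀ hdim₀ w hw γ s₀ hγ hs₀
    -- the data reproduce themselves at `x'`
    obtain ⟨hX', hC'reg, hdim'⟩ := strictTransform_curve_data_of_isBlowup_point hX hx hYreg hτ hCreg hxC hdim hx'
    haveI : IsRegularLocalRing (X'.presheaf.stalk x') := hX' x'
    have hPle : stalkIdeal (vanishingIdeal C) (τ x') ≤ maximalIdeal _ := le_sup_left.trans he.le
    -- ONE new exceptional coordinate `e'` at `x'`, with `τ^#(e) = v₁ e'`
    obtain ⟨e', he'gen, htr', γ₁, hγ₁, v₁, hv₁, π₁, hπ₁, -, h2⟩ :=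
      contact_drop_of_isBlowup_point hX hx hYreg hτ hCreg hxC hdim hx' e 1 1 0 he isUnit_one (Ideal.zero_mem _) 1 le_rfl 1 0
    have heimg : (τ.stalkMap x').hom e = v₁ * e' := by
      simpa using h2
    refine ⟨hX', hC'reg, hx', hdim', e', htr', fun i => ?_⟩
    obtain ⟨c, γ', π', hc, hγ', hπ', hsimg⟩ := hfam i
    -- restate the induction hypothesis with the instances of the current stalk (same term up to unfolding)
    have hsimg' : (σ.stalkMap (τ x')).hom (γ i * w ^ k i + s₀ i) = c * e ^ min n (k i) * (γ' * e ^ (k i - n) + π') := hsimg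
    by_cases hnk : n < k i
    · -- within the contact: one more unit of contact is used up
      have hk1 : 1 ≤ k i - n := by omega
      obtain ⟨e₂, he₂gen, -, γ₂, hγ₂, v₂, -, π₂, hπ₂, h1, -⟩ :=
        contact_drop_of_isBlowup_point hX hx hYreg hτ hCreg hxC hdim hx' e γ' 1 π' he hγ' hπ' (k i - n) hk1 1 0
      -- align the two exceptional coordinates: `e₂ = d • e'` with `d` a unit
      obtain ⟨d, hd, hde⟩ := exists_isUnit_mul_eq_of_span_singleton_eq (he₂gen.symm.trans he'gen)
      have hmin : min n (k i) = n := Nat.min_eq_left hnk.le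
      have hmin' : min (n + 1) (k i) = n + 1 := Nat.min_eq_left (by omega)
      refine ⟨(τ.stalkMap x').hom c * v₁ ^ n * d, γ₂ * d ^ (k i - n - 1), π₂,
        ((hc.map _).mul (hv₁.pow n)).mul hd, hγ₂.mul (hd.pow _), hπ₂, ?_⟩
      rw [Scheme.Hom.stalkMap_comp]
      change (τ.stalkMap x').hom ((σ.stalkMap (τ x')).hom (γ i * w ^ k i + s₀ i)) = _
      rw [hsimg', map_mul, map_mul, map_pow, heimg, h1, hde, hmin, hmin', show k i - (n + 1) = k i - n - 1 by omega]
      have hsplit : (d * e') ^ (k i - n - 1) = d ^ (k i - n - 1) * e' ^ (k i - n - 1) := mul_pow _ _ _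
      rw [hsplit]
      ring
    · -- past the contact: the residual factor is a unit and is carried along
      have hkn : k i ≤ n := Nat.le_of_not_lt hnk
      have hmin : min n (k i) = k i := Nat.min_eq_right hkn
      have hmin' : min (n + 1) (k i) = k i := Nat.min_eq_right (by omega)
      have hsub : k i - n = 0 := Nat.sub_eq_zero_of_le hkn
      have hsub' : k i - (n + 1) = 0 := Nat.sub_eq_zero_of_le (by omega)
      have hunit : IsUnit (γ' + π') := by
        by_contra hnu
        have hm : γ' + π' ∈ maximalIdeal (X.presheaf.stalk (τ x')) := (mem_maximalIdeal _).mpr hnu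
        have h2' : γ' + π' - π' ∈ maximalIdeal (X.presheaf.stalk (τ x')) := Ideal.sub_mem _ hm (hPle hπ')
        rw [add_sub_cancel_right] at h2'
        exact (mem_maximalIdeal _).mp h2' hγ'
      refine ⟨(τ.stalkMap x').hom c * v₁ ^ k i, (τ.stalkMap x').hom (γ' + π'), 0,
        (hc.map _).mul (hv₁.pow _), hunit.map _, Ideal.zero_mem _, ?_⟩
      rw [Scheme.Hom.stalkMap_comp]
      change (τ.stalkMap x').hom ((σ.stalkMap (τ x')).hom (γ i * w ^ k i + s₀ i)) = _
      rw [hsimg', hmin, hsub, hmin', hsub', pow_zero, mul_one, pow_zero, mul_one, add_zero, map_mul, map_mul, map_pow, heimg, mul_pow]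
      ring

/-- **L7b phase 1 for several transversal components, charged landing.**  `X₀` regular locally Noetherian, `C₀` a regular curve through
`x₀ = σ x` with `dim 𝒪_{X₀,x₀} = 3`, `w` a coordinate transversal to `C₀` at `x₀`, and a non-trivial representative of the `K^p`-line of `G`
presented at `x₀` as `u₀ · ∏_i (γ_i w^{k_i} + s₀ᵢ)^{a_i}` (`u₀, γ_i` units, `s₀ᵢ ∈ 𝓘_{C₀,x₀}`: `m` old clean components not containing the
curve, in contact normal form with contacts `k_i`).  Along ANY chain of `n ≥ max_i k_i` point blowing ups following the curve, at the end
point `x` the line of `σ^♯ G` is `(unit) · e^{Σ_i k_i a_i}` with `e` transversal to the strict transform `C`; if `p ∤ Σ_i k_i a_i` it is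
clean-permissible for the centre `C` at `x`. [cite: CossartJannsenSaito2020, proof of Thm. 6.28, Step 5]
[cite: CossartPiltant2008, Prop. 4.4 (proof, p. 10)] -/
theorem cleanPermissibleAt_of_pointChain_chargedLanding_family {X₀ X : Scheme.{u}} [IsIntegral X₀] [IsIntegral X] {σ : X ⟶ X₀}
    [IsDominant σ] {C₀ : Closeds X₀} {C : Closeds X} {x : X} {n : ℕ} (h : IsPointChainAlong σ C₀ C x n)
    [IsLocallyNoetherian X₀] [IsLocallyNoetherian X] (hX₀ : Scheme.IsRegular X₀)
    (hC₀reg : ∀ y ∈ (C₀ : Set X₀), ∃ c : Fin 2 → X₀.presheaf.stalk y,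
      IsRsopPart c ∧ Ideal.span (Set.range c) = stalkIdeal (vanishingIdeal C₀) y)
    (hxC₀ : σ x ∈ (C₀ : Set X₀)) (hdim₀ : ringKrullDim (X₀.presheaf.stalk (σ x)) = 3)
    (p : ℕ) (G : X₀.functionField) (cc : Fin p → X₀.functionField) (hcc : ∃ j : Fin p, (j : ℕ) ≠ 0 ∧ cc j ≠ 0)
    (w u₀ : X₀.presheaf.stalk (σ x)) (hw : stalkIdeal (vanishingIdeal C₀) (σ x) ⊔ Ideal.span {w} = maximalIdeal _)
    (hu₀ : IsUnit u₀) {m : ℕ} (γ s₀ : Fin m → X₀.presheaf.stalk (σ x)) (hγ : ∀ i, IsUnit (γ i))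
    (hs₀ : ∀ i, s₀ i ∈ stalkIdeal (vanishingIdeal C₀) (σ x)) (k a : Fin m → ℕ) (hkn : ∀ i, k i ≤ n)
    (hp : ¬ p ∣ ∑ i, k i * a i)
    (hX : (∑ j : Fin p, cc j ^ p * G ^ (j : ℕ)) =
      RatFn.toFunctionField (σ x) (u₀ * ∏ i, (γ i * w ^ k i + s₀ i) ^ a i)) :
    CleanPermissibleAt p (RatFn.toFunctionField x) (RatFn.functionFieldMap σ G) (stalkIdeal (vanishingIdeal C) x) := by
  obtain ⟨hXreg, hCreg, hxC, hdim, e, he, hfam⟩ :=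
    contact_family_along_pointChain h hX₀ hC₀reg hxC₀ hdim₀ w hw γ s₀ hγ hs₀ k
  -- the local rings at `x`
  haveI : IsRegularLocalRing (X.presheaf.stalk x) := hXreg x
  obtain ⟨c2, hc2, hspan⟩ := hCreg x hxC
  haveI : IsRegularLocalRing (X.presheaf.stalk x ⧸ stalkIdeal (vanishingIdeal C) x) := by
    rw [← hspan]; exact hc2.isRegularLocalRing_quotient
  have hP1 : ringKrullDim (X.presheaf.stalk x ⧸ stalkIdeal (vanishingIdeal C) x) = 1 := by
    rw [← hspan]; exact ringKrullDim_quotient_span_pair_eq_one hc2 hdim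
  have hPle : stalkIdeal (vanishingIdeal C) x ≤ maximalIdeal _ := le_sup_left.trans he.le
  -- per member: `σ^#(s_i) = e^{k_i} · W_i` with `W_i` a unit (the chain is at least as long as every contact)
  choose c γ' π' hc hγ' hπ' hsimg using hfam
  have hW : ∀ i, IsUnit (c i * (γ' i + π' i)) := by
    intro i
    refine (hc i).mul ?_
    by_contra hnu
    have hm : γ' i + π' i ∈ maximalIdeal (X.presheaf.stalk x) := (mem_maximalIdeal _).mpr hnu
    have h2 : γ' i + π' i - π' i ∈ maximalIdeal (X.presheaf.stalk x) := Ideal.sub_mem _ hm (hPle (hπ' i))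
    rw [add_sub_cancel_right] at h2
    exact (mem_maximalIdeal _).mp h2 (hγ' i)
  have hsimg' : ∀ i, (σ.stalkMap x).hom (γ i * w ^ k i + s₀ i) = (c i * (γ' i + π' i)) * e ^ k i := by
    intro i
    rw [hsimg i, Nat.min_eq_right (hkn i), Nat.sub_eq_zero_of_le (hkn i), pow_zero, mul_one]
    ring
  -- the unit `U` and the presentation `U · e^{Σ k_i a_i}` upstairs
  set U : X.presheaf.stalk x := (σ.stalkMap x).hom u₀ * ∏ i, (c i * (γ' i + π' i)) ^ a i with hU
  have hUunit : IsUnit U := (hu₀.map _).mul (IsUnit.prod_univ_iff.mpr fun i => (hW i).pow _)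
  have himg : (σ.stalkMap x).hom (u₀ * ∏ i, (γ i * w ^ k i + s₀ i) ^ a i) = U * e ^ (∑ i, k i * a i) := by
    rw [map_mul, map_prod]
    simp only [map_pow, hsimg', mul_pow, ← pow_mul, Finset.prod_mul_distrib, Finset.prod_pow_eq_pow_sum, hU]
    ring
  have hX' : (∑ j : Fin p, (RatFn.functionFieldMap σ (cc j)) ^ p * (RatFn.functionFieldMap σ G) ^ (j : ℕ)) =
      RatFn.toFunctionField x (U * e ^ (∑ i, k i * a i)) := by
    calc (∑ j : Fin p, (RatFn.functionFieldMap σ (cc j)) ^ p * (RatFn.functionFieldMap σ G) ^ (j : ℕ))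
        = RatFn.functionFieldMap σ (∑ j : Fin p, cc j ^ p * G ^ (j : ℕ)) := by
          rw [map_sum]; simp only [map_mul, map_pow]
      _ = RatFn.functionFieldMap σ (RatFn.toFunctionField (σ x) (u₀ * ∏ i, (γ i * w ^ k i + s₀ i) ^ a i)) := by rw [hX]
      _ = RatFn.toFunctionField x ((σ.stalkMap x) (u₀ * ∏ i, (γ i * w ^ k i + s₀ i) ^ a i)) :=
          RatFn.functionFieldMap_toFunctionField σ x _
      _ = RatFn.toFunctionField x (U * e ^ (∑ i, k i * a i)) := congrArg (RatFn.toFunctionField x) himg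
  have hcc' : ∃ j : Fin p, (j : ℕ) ≠ 0 ∧ RatFn.functionFieldMap σ (cc j) ≠ 0 := by
    obtain ⟨j, hj, hj0⟩ := hcc
    exact ⟨j, hj, fun h0 => hj0 ((RatFn.functionFieldMap σ).injective (by rw [h0, map_zero]))⟩
  exact cleanPermissibleAt_of_chargedLanding p (RatFn.toFunctionField x) (RatFn.functionFieldMap σ G) _ hP1 _ hcc' e he _
    hp U hUunit hX'

end Summit.ResolutionOfSingularities.ResolutionOfSingularities.Theorems.RadicialJung.CleanModels

end
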